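import Summits.AtomisticToContinuum.BoseEinsteinCondensation.Theses.BECSubharmonicContinuation

/-!
# AtomisticToContinuum / BoseEinsteinCondensation — route `BECSubharmonicContinuation`, assembly

Settles the assembly item `stmt-AtomisticToContinuum-14639` of route
`route-AtomisticToContinuum-BECSubharmonicContinuation`: the implication
`SubharmonicCoherence → HealingScaleDeficit → ContinuationToPeriodicBEC → BoundaryTransferWeak →
BoseEinsteinCondensation` (the audited sub-problem statement `_root_.BoseEinsteinCondensation`, by
name).

The chain is the route's thesis displayed as one implication: the glue
`ContinuationToPeriodicBEC : SubharmonicCoherence → HealingScaleDeficit → PeriodicBEC` turns the two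
cruxes S1 (subharmonic kinetic coherence beyond `M` healing lengths) and S2 (healing-scale
condensation deficit) into constant-mode BEC for periodic near-minimisers on the thermodynamic torus,
and the route's deciding theorem `closes (hP : PeriodicBEC) (hB : BoundaryTransferWeak)` turns that,
with the mode-free boundary transfer, into the Dirichlet conjunct. Pure logic; no analytic content
lives here.
-/

namespace Summit.AtomisticToContinuum.BoseEinsteinCondensation.Theorems

/-- Settles `stmt-AtomisticToContinuum-14639` (exact signature): the assembly of route
`BECSubharmonicContinuation`, i.e. `SubharmonicCoherence → HealingScaleDeficit →
ContinuationToPeriodicBEC → BoundaryTransferWeak → BoseEinsteinCondensation`. Proof: the glue applied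
to S1 and S2 gives `PeriodicBEC`, and the deciding theorem `closes` composes it with
`BoundaryTransferWeak`. [folklore] -/
theorem becSubharmonicContinuation_assembly_proof :
    Summit.AtomisticToContinuum.BoseEinsteinCondensation.Theses.BECSubharmonicContinuation.Assembly := by
  unfold Theses.BECSubharmonicContinuation.Assembly
  intro h₁ h₂ h₈ h₉
  exact Theses.BECSubharmonicContinuation.closes (h₈ h₁ h₂) h₉

end Summit.AtomisticToContinuum.BoseEinsteinCondensation.Theorems
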